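import Mathlib
import HarnessLib
import Summits.NavierStokesRegularity.NavierStokesRegularity.Theses.IsobarTomography

/-!
# Crux-strategist census sketches for `IsobaricLinesLiouville` (stmt-NavierStokesRegularity-11741)

Typed forms of the decomposition / strengthening candidates examined in `STRATEGY-CENSUS.md`
(planner-cstrat-stmt-NavierStokesRegularity-11741-s1-0, 2026-08-17). Nothing here is filed as an
item: the file only certifies that the candidate splits are TYPED and that their glue to the crux
is pure logic, so that the census can say precisely which piece stays crux-sized.
-/

noncomputable section

set_option linter.dupNamespace false

namespace Summit.NavierStokesRegularity.NavierStokesRegularity.Cruxes.IsobaricLinesLiouville.Strategist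

open scoped InnerProductSpace RealInnerProductSpace Topology Laplacian
open Literature.Analysis.FluidPDE Set
open Summit.NavierStokesRegularity.NavierStokesRegularity.Theses.IsobarTomography

/-- Membership in the crux's class: bounded ancient mild (ν = 1), classical on `(-∞,0)` with
pressure `q`, vortex lines on isobars. -/
def InClass (v : ℝ → EuclideanSpace ℝ (Fin 3) → EuclideanSpace ℝ (Fin 3))
    (q : ℝ → EuclideanSpace ℝ (Fin 3) → ℝ) : Prop :=
  IsBoundedAncientMildSolution 1 v ∧ IsClassicalNSSolutionOn (Set.Iio 0) 1 0 v q ∧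
    ∀ t < 0, ∀ x : EuclideanSpace ℝ (Fin 3), ⟪curl (v t) x, gradient (q t) x⟫_ℝ = 0

/-- The crux's conclusion. -/
def SliceConst (v : ℝ → EuclideanSpace ℝ (Fin 3) → EuclideanSpace ℝ (Fin 3)) : Prop :=
  ∀ t < 0, ∃ b : EuclideanSpace ℝ (Fin 3), v t = fun _ => b

/-- The crux, restated through `InClass` (definitionally the route decl up to currying). -/
theorem crux_iff : IsobaricLinesLiouville ↔ ∀ v q, InClass v q → SliceConst v := by
  constructor
  · intro h v q hc
    exact h v q hc.1 hc.2.1 hc.2.2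
  · intro h v q hv hcl hiso
    exact h v q ⟨hv, hcl, hiso⟩

/-! ## Decomposition candidate Dec₁ — steady (travelling-wave) split -/

/-- Steady in a Galilean frame moving with constant velocity `c`. -/
def IsTravelling (v : ℝ → EuclideanSpace ℝ (Fin 3) → EuclideanSpace ℝ (Fin 3)) : Prop :=
  ∃ c : EuclideanSpace ℝ (Fin 3), ∀ t < 0, ∀ s < 0, ∀ x : EuclideanSpace ℝ (Fin 3),
    v t x = v s (x - (t - s) • c)

/-- Sub₁ (the dynamical half): a non-slice-constant element of the class yields a non-slice-constant
TRAVELLING element of the class (e.g. as an α-limit / extremal translate). -/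
def AncientToTravelling : Prop :=
  ∀ v q, InClass v q → ¬ SliceConst v →
    ∃ V Q, InClass V Q ∧ IsTravelling V ∧ ¬ SliceConst V

/-- Sub₂ (the static half): the steady / travelling-wave isobaric Liouville theorem. -/
def TravellingIsobaricLiouville : Prop :=
  ∀ v q, InClass v q → IsTravelling v → SliceConst v

/-- Glue of Dec₁ (pure logic). -/
theorem crux_of_dec1 (h₁ : AncientToTravelling) (h₂ : TravellingIsobaricLiouville) :
    IsobaricLinesLiouville := by
  rw [crux_iff]
  intro v q hc
  by_contra hne
  obtain ⟨V, Q, hVQ, hT, hnc⟩ := h₁ v q hc hne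
  exact hnc (h₂ V Q hVQ hT)

/-- Both halves are implied by the crux (so the split is lossless). -/
theorem dec1_of_crux (h : IsobaricLinesLiouville) :
    AncientToTravelling ∧ TravellingIsobaricLiouville := by
  rw [crux_iff] at h
  exact ⟨fun v q hc hne => (hne (h v q hc)).elim, fun v q hc _ => h v q hc⟩

/-! ## Decomposition candidate Dec₂ — pressure split (affine-pressure leaf) -/

/-- Sub₁': in the class the pressure Hessian vanishes (pressure affine in `x` on every slice,
`Δq = ½‖ω‖² − ‖S‖² ≡ 0`). -/
def AffinePressure : Prop :=
  ∀ v q, InClass v q → ∀ t < 0, ∀ x : EuclideanSpace ℝ (Fin 3), fderiv ℝ (gradient (q t)) x = 0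

/-- Sub₂': the isobaric affine-pressure (pressureless in an accelerated frame) Liouville theorem. -/
def AffinePressureLiouville : Prop :=
  ∀ v q, InClass v q →
    (∀ t < 0, ∀ x : EuclideanSpace ℝ (Fin 3), fderiv ℝ (gradient (q t)) x = 0) → SliceConst v

/-- Glue of Dec₂ (pure logic). -/
theorem crux_of_dec2 (h₁ : AffinePressure) (h₂ : AffinePressureLiouville) :
    IsobaricLinesLiouville := by
  rw [crux_iff]
  intro v q hc
  exact h₂ v q hc (h₁ v q hc)

/-! ## Decomposition candidate Dec₄ — regime split by a property `P` (template)

Any predicate `P` on class elements splits the crux losslessly into "`P`-elements are constant" and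
"`¬P`-elements are constant"; the census instantiates `P` = "has a compact regular isobar component
inside `{ω ≠ 0}` on some slice" (Cowling split) and `P` = "Type-I scale-invariant bound" and records
why neither instance separates the tools. -/

/-- Regime split template. -/
theorem crux_of_regimeSplit
    (P : (ℝ → EuclideanSpace ℝ (Fin 3) → EuclideanSpace ℝ (Fin 3)) →
      (ℝ → EuclideanSpace ℝ (Fin 3) → ℝ) → Prop)
    (hP : ∀ v q, InClass v q → P v q → SliceConst v)
    (hnP : ∀ v q, InClass v q → ¬ P v q → SliceConst v) : IsobaricLinesLiouville := by
  rw [crux_iff]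
  intro v q hc
  by_cases h : P v q
  · exact hP v q hc h
  · exact hnP v q hc h

/-! ## Strengthening candidate S⁺₂ — first-prolongation class (`Δω ⊥ ∇q` as an EXTRA hypothesis)

The transfer analysis of the census shows the KNSS frozen-gauge scalar needs `Δω ∥ ω`, in particular
`Δω·∇q ≡ 0`, on top of isobaricity. The WEAKENED crux below (extra hypothesis) is what the transferred
engine would at best prove; it does not imply the crux, which is why the transfer has no teeth. -/

/-- Isobaric AND first-prolongation-flat elements are slice-constant (weaker than the crux). -/
def ProlongationFlatLiouville : Prop :=
  ∀ v q, InClass v q →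
    (∀ t < 0, ∀ x : EuclideanSpace ℝ (Fin 3),
      ⟪(Δ (curl (v t))) x, gradient (q t) x⟫_ℝ = 0) → SliceConst v

theorem prolongationFlat_of_crux (h : IsobaricLinesLiouville) : ProlongationFlatLiouville := by
  rw [crux_iff] at h
  exact fun v q hc _ => h v q hc

end Summit.NavierStokesRegularity.NavierStokesRegularity.Cruxes.IsobaricLinesLiouville.Strategist

end
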